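import Summits.ResolutionOfSingularities.ResolutionOfSingularities.Theorems.EquisingularLiftEquisingularLiftNatNoseLiftEmptyInstances
import HarnessLib

/-!
# [OURS · L1 W4.5(b) · EL♮(3) · WIDTH TABLE D15 «ν-LIFT DOOR»] THE DOOR-LEVEL INCLUSIONS ν3ᶜⁱΣPG ⊂ νLIFT AND ν3ᵈΣPG ⊂ νLIFT AT `T₁ = range ι`
# `reachLiftNoseSigmaPG₂_of_directCISigmaPG₂` / `reachLiftNoseSigmaPG₂_of_directPlanarSigmaPG₂` — the text of desk R78 (iv)'s LATER «repackaging-drop» REPLACE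

res-L1-w45b-nose-w1 g7 (WIDTH seat D-0157 DOOR 1).  SCRATCH toward the desk's booked-for-later REPLACE «D9/D11 become droppable by the two S-lemmas» (R78 (iv)):
with `S := ∅` the ν-LIFT door ✓ `ReachLiftNoseSigmaPG₂` (res-type-027 …DefsE8) CONTAINS the direct doors ✓ `ReachDirectCINoseSigmaPG₂` / ✓ `ReachDirectPlanarNoseSigmaPG₂`
(…DefsE7) at the blob's `T₁ = range ι`: the slot by ✓-pending `LiftNose.noseLift₀_empty_of_ci` / `…_of_planar` (…NatNoseLiftEmptyInstances), the sections blow-up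
`υ := 𝟙` (Literature ✓ `isBlowup_id_top`, `𝓘⟨∅⟩ = ⊤`), and every later letter of the word transported along `closure (𝟙 ⁻¹' (Z ∖ ∅)) = Z`,
`closure (𝟙 ⁻¹' (range ι ∖ ∅)) = range ι` by generalising the word over the two strict transforms (dependent rewriting under `redSub`/`isClosed_closure`).
Needs `range ι` closed (the rung's `IsClosedImmersion ι`).  OURS; NOT a statement of any manuscript ([Hironaka2017] is a candidate under adjudication, nothing of it is
asserted); AI-written, weaker than expert review.  DEF-FREE; no `sorry`; standard axioms; pure logic over ✓ modules.
`--kind proof --supports stmt-ResolutionOfSingularities-20148 --as helper`, counted 0.  EL♮(3) is NOT proved here.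
-/

set_option linter.dupNamespace false -- mandated namespace `Summit.<Summit>.<Problem>` of this single-conjunct summit

noncomputable section

open CategoryTheory CategoryTheory.Limits AlgebraicGeometry TopologicalSpace Topology IsLocalRing
open MvPolynomial
open Literature.AlgebraicGeometry.Resolution
open AlgebraicGeometry.Scheme.IdealSheafData

namespace Summit.ResolutionOfSingularities.ResolutionOfSingularities.Cruxes.EquisingularLiftNat.Sections.LiftNose

/-- ★ **ν3ᶜⁱΣPG ⊂ νLIFT at `T₁ = range ι`**: `ReachDirectCINoseSigmaPG₂ k 3 (range ι) F₉ β T₉ E₉ → ReachLiftNoseSigmaPG₂ k 3 H ι (range ι) F₉ β T₉ E₉` (`S := ∅`, `υ := 𝟙`;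
slot by `noseLift₀_empty_of_ci`). [OURS · pure logic; text of the later D11-drop REPLACE; counted 0; EL♮(3) NOT proved] -/
theorem reachLiftNoseSigmaPG₂_of_directCISigmaPG₂ (k : Type) [Field k] [IsAlgClosed k] (H : AlgebraicGeometry.Scheme.{0})
    (ι : H ⟶ (Literature.AlgebraicGeometry.Motives.projectiveSpace 3 k).left) (hTcl : IsClosed (Set.range ι))
    (F₉ : Scheme.{0}) (β : F₉ ⟶ (Literature.AlgebraicGeometry.Motives.projectiveSpace 3 k).left) (T₉ E₉ : Set F₉)
    (h : ReachDirectCINoseSigmaPG₂ k 3 (Set.range ι) F₉ β T₉ E₉) : ReachLiftNoseSigmaPG₂ k 3 H ι (Set.range ι) F₉ β T₉ E₉ := by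
  classical
  letI := MvPolynomial.gradedAlgebra (σ := Fin (3 + 1)) (R := k)
  obtain ⟨hE₉, Z, hZ, hZT, hTZ, hZinf, hZdim, hN1, ⟨d₁, d₂, f₁, f₂, hf₁, hf₂, hZeq, hrel, hf₂0, hrad, hJ⟩,
    F₃, υ', hυ', γ', E', Es', Ns', K', htail, hβ⟩ := h
  have hslot : NoseLift₀ k 3 H ι Z hZ ∅ isClosed_empty :=
    noseLift₀_empty_of_ci k H ι Z hZ hN1 d₁ d₂ f₁ f₂ hf₁ hf₂ hrel hf₂0 hrad hZeq hJ hTZ isClosed_empty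
  -- the door's word after the (trivial) sections blow-up `υ := 𝟙`, GENERALISED over the strict transforms `T₂ = range ι`, `W = Z` (dependent rewriting)
  have key : ∀ (T₂ W : Set (Literature.AlgebraicGeometry.Motives.projectiveSpace 3 k).left) (hW : IsClosed W), T₂ = Set.range ι → W = Z →
      ((∀ z : ↥(redSub (Literature.AlgebraicGeometry.Motives.projectiveSpace 3 k).left W hW), IsClosed ({z} : Set ↥(redSub (Literature.AlgebraicGeometry.Motives.projectiveSpace 3 k).left W hW)) →
          ringKrullDim ((redSub (Literature.AlgebraicGeometry.Motives.projectiveSpace 3 k).left W hW).presheaf.stalk z) = ((1 : ℕ) : WithBot ℕ∞)) ∧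
        ∃ (F₃ : Scheme.{0}) (υ' : F₃ ⟶ (Literature.AlgebraicGeometry.Motives.projectiveSpace 3 k).left),
          IsBlowup υ' (vanishingIdeal (⟨W, hW⟩ : Closeds (Literature.AlgebraicGeometry.Motives.projectiveSpace 3 k).left)) ∧
          ∃ (γ' : F₉ ⟶ F₃) (E' : Set F₉) (Es' Ns' : List (Set F₉)) (K' : Set F₉),
            (∀ R : (∀ G : Scheme.{0}, (G ⟶ F₃) → Set G → Set G → List (Set G) → List (Set G) → Set G → Prop),
              R F₃ (𝟙 F₃) (closure (υ' ⁻¹' (T₂ \ W))) (υ' ⁻¹' W) [] [] ∅ →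
              TowerPtRegB₄ F₃ R → TowerPtRamB₄ F₃ R → TowerRoundBTriplePrime (Literature.AlgebraicGeometry.Motives.projectiveSpace 3 k).left F₃ υ' W hW R →
              TowerSecRoundSigma (Literature.AlgebraicGeometry.Motives.projectiveSpace 3 k).left F₃ υ' W hW R →
              TowerPRamGamma (Literature.AlgebraicGeometry.Motives.projectiveSpace 3 k).left F₃ υ' W hW R →
              R F₉ γ' T₉ E' Es' Ns' K') ∧
            β = γ' ≫ υ' ≫ 𝟙 (Literature.AlgebraicGeometry.Motives.projectiveSpace 3 k).left) := by
    rintro T₂ W hW rfl rfl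
    exact ⟨hZdim, F₃, υ', hυ', γ', E', Es', Ns', K', htail, by rw [Category.comp_id]; exact hβ⟩
  -- `𝓘⟨∅⟩ = ⊤`, so `𝟙` is its blow-up; the strict transforms under `𝟙` are the sets themselves
  have hbot : (⟨∅, isClosed_empty⟩ : Closeds (Literature.AlgebraicGeometry.Motives.projectiveSpace 3 k).left) = ⊥ := Closeds.ext rfl
  have hpre : ∀ A : Set (Literature.AlgebraicGeometry.Motives.projectiveSpace 3 k).left, (𝟙 (Literature.AlgebraicGeometry.Motives.projectiveSpace 3 k).left : (Literature.AlgebraicGeometry.Motives.projectiveSpace 3 k).left ⟶ (Literature.AlgebraicGeometry.Motives.projectiveSpace 3 k).left) ⁻¹' (A \ ∅) = A := fun A => by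
    rw [Set.sdiff_empty]; rfl
  have hW : closure ((𝟙 (Literature.AlgebraicGeometry.Motives.projectiveSpace 3 k).left : (Literature.AlgebraicGeometry.Motives.projectiveSpace 3 k).left ⟶ (Literature.AlgebraicGeometry.Motives.projectiveSpace 3 k).left) ⁻¹' (Z \ ∅)) = Z := by rw [hpre, hZ.closure_eq]
  have hT : closure ((𝟙 (Literature.AlgebraicGeometry.Motives.projectiveSpace 3 k).left : (Literature.AlgebraicGeometry.Motives.projectiveSpace 3 k).left ⟶ (Literature.AlgebraicGeometry.Motives.projectiveSpace 3 k).left) ⁻¹' (Set.range ι \ ∅)) = Set.range ι := by rw [hpre, hTcl.closure_eq]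
  refine ⟨hE₉, Z, hZ, hZT, hTZ, hZinf, hZdim, hN1, ∅, isClosed_empty, fun _ h => h.elim, hslot, (Literature.AlgebraicGeometry.Motives.projectiveSpace 3 k).left, 𝟙 _, ?_, key _ _ _ hT hW⟩
  rw [hbot, vanishingIdeal_bot]
  exact isBlowup_id_top _

/-- ★ **ν3ᵈΣPG ⊂ νLIFT at `T₁ = range ι`**: `ReachDirectPlanarNoseSigmaPG₂ k 3 ℓ (range ι) F₉ β T₉ E₉ → ReachLiftNoseSigmaPG₂ k 3 H ι (range ι) F₉ β T₉ E₉` for a linear form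
`ℓ ≠ 0` (`S := ∅`, `υ := 𝟙`; slot by `noseLift₀_empty_of_planar`; the door's `IsPreirreducible Z`, ambient-regularity and host-dimension letters are not needed).
[OURS · pure logic; text of the later D9-drop REPLACE; counted 0; EL♮(3) NOT proved] -/
theorem reachLiftNoseSigmaPG₂_of_directPlanarSigmaPG₂ (k : Type) [Field k] [IsAlgClosed k] (H : AlgebraicGeometry.Scheme.{0})
    (ι : H ⟶ (Literature.AlgebraicGeometry.Motives.projectiveSpace 3 k).left) (hTcl : IsClosed (Set.range ι))
    (ℓ : MvPolynomial (Fin (3 + 1)) k) (hℓ1 : ℓ.IsHomogeneous 1) (hℓ0 : ℓ ≠ 0)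
    (F₉ : Scheme.{0}) (β : F₉ ⟶ (Literature.AlgebraicGeometry.Motives.projectiveSpace 3 k).left) (T₉ E₉ : Set F₉)
    (h : ReachDirectPlanarNoseSigmaPG₂ k 3 ℓ (Set.range ι) F₉ β T₉ E₉) : ReachLiftNoseSigmaPG₂ k 3 H ι (Set.range ι) F₉ β T₉ E₉ := by
  classical
  letI := MvPolynomial.gradedAlgebra (σ := Fin (3 + 1)) (R := k)
  obtain ⟨hE₉, Z, hZ, hZT, hTZ, hZinf, -, -, hZdim, -, hEreg, -, hN1, ⟨e, g, B, r, hg, hsq, hZeq, hℓB, hr, hdet⟩,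
    F₃, υ', hυ', γ', E', Es', Ns', K', htail, hβ⟩ := h
  have hslot : NoseLift₀ k 3 H ι Z hZ ∅ isClosed_empty :=
    noseLift₀_empty_of_planar k H ι ℓ hℓ1 hℓ0 Z hZ hEreg hN1 e g B r hg hsq hZeq hℓB hr hdet hTZ isClosed_empty
  -- the door's word after the (trivial) sections blow-up `υ := 𝟙`, GENERALISED over the strict transforms `T₂ = range ι`, `W = Z` (dependent rewriting)
  have key : ∀ (T₂ W : Set (Literature.AlgebraicGeometry.Motives.projectiveSpace 3 k).left) (hW : IsClosed W), T₂ = Set.range ι → W = Z →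
      ((∀ z : ↥(redSub (Literature.AlgebraicGeometry.Motives.projectiveSpace 3 k).left W hW), IsClosed ({z} : Set ↥(redSub (Literature.AlgebraicGeometry.Motives.projectiveSpace 3 k).left W hW)) →
          ringKrullDim ((redSub (Literature.AlgebraicGeometry.Motives.projectiveSpace 3 k).left W hW).presheaf.stalk z) = ((1 : ℕ) : WithBot ℕ∞)) ∧
        ∃ (F₃ : Scheme.{0}) (υ' : F₃ ⟶ (Literature.AlgebraicGeometry.Motives.projectiveSpace 3 k).left),
          IsBlowup υ' (vanishingIdeal (⟨W, hW⟩ : Closeds (Literature.AlgebraicGeometry.Motives.projectiveSpace 3 k).left)) ∧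
          ∃ (γ' : F₉ ⟶ F₃) (E' : Set F₉) (Es' Ns' : List (Set F₉)) (K' : Set F₉),
            (∀ R : (∀ G : Scheme.{0}, (G ⟶ F₃) → Set G → Set G → List (Set G) → List (Set G) → Set G → Prop),
              R F₃ (𝟙 F₃) (closure (υ' ⁻¹' (T₂ \ W))) (υ' ⁻¹' W) [] [] ∅ →
              TowerPtRegB₄ F₃ R → TowerPtRamB₄ F₃ R → TowerRoundBTriplePrime (Literature.AlgebraicGeometry.Motives.projectiveSpace 3 k).left F₃ υ' W hW R →
              TowerSecRoundSigma (Literature.AlgebraicGeometry.Motives.projectiveSpace 3 k).left F₃ υ' W hW R →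
              TowerPRamGamma (Literature.AlgebraicGeometry.Motives.projectiveSpace 3 k).left F₃ υ' W hW R →
              R F₉ γ' T₉ E' Es' Ns' K') ∧
            β = γ' ≫ υ' ≫ 𝟙 (Literature.AlgebraicGeometry.Motives.projectiveSpace 3 k).left) := by
    rintro T₂ W hW rfl rfl
    exact ⟨hZdim, F₃, υ', hυ', γ', E', Es', Ns', K', htail, by rw [Category.comp_id]; exact hβ⟩
  -- `𝓘⟨∅⟩ = ⊤`, so `𝟙` is its blow-up; the strict transforms under `𝟙` are the sets themselves
  have hbot : (⟨∅, isClosed_empty⟩ : Closeds (Literature.AlgebraicGeometry.Motives.projectiveSpace 3 k).left) = ⊥ := Closeds.ext rfl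
  have hpre : ∀ A : Set (Literature.AlgebraicGeometry.Motives.projectiveSpace 3 k).left, (𝟙 (Literature.AlgebraicGeometry.Motives.projectiveSpace 3 k).left : (Literature.AlgebraicGeometry.Motives.projectiveSpace 3 k).left ⟶ (Literature.AlgebraicGeometry.Motives.projectiveSpace 3 k).left) ⁻¹' (A \ ∅) = A := fun A => by
    rw [Set.sdiff_empty]; rfl
  have hW : closure ((𝟙 (Literature.AlgebraicGeometry.Motives.projectiveSpace 3 k).left : (Literature.AlgebraicGeometry.Motives.projectiveSpace 3 k).left ⟶ (Literature.AlgebraicGeometry.Motives.projectiveSpace 3 k).left) ⁻¹' (Z \ ∅)) = Z := by rw [hpre, hZ.closure_eq]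
  have hT : closure ((𝟙 (Literature.AlgebraicGeometry.Motives.projectiveSpace 3 k).left : (Literature.AlgebraicGeometry.Motives.projectiveSpace 3 k).left ⟶ (Literature.AlgebraicGeometry.Motives.projectiveSpace 3 k).left) ⁻¹' (Set.range ι \ ∅)) = Set.range ι := by rw [hpre, hTcl.closure_eq]
  refine ⟨hE₉, Z, hZ, hZT, hTZ, hZinf, hZdim, hN1, ∅, isClosed_empty, fun _ h => h.elim, hslot, (Literature.AlgebraicGeometry.Motives.projectiveSpace 3 k).left, 𝟙 _, ?_, key _ _ _ hT hW⟩
  rw [hbot, vanishingIdeal_bot]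
  exact isBlowup_id_top _

end Summit.ResolutionOfSingularities.ResolutionOfSingularities.Cruxes.EquisingularLiftNat.Sections.LiftNose

end
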